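import Literature.NumberTheory.ComplexMultiplication.EllipticUnits.RubinTheta
import Mathlib.RingTheory.DedekindDomain.Ideal.Lemmas
import Mathlib.RingTheory.Algebraic.Integral
import HarnessLib

/-!
# The normal form of a CM lattice relative to a primitive division point:
# `Λ = v · 𝔠⁻¹ι(𝔤)` for an integral ideal `𝔠` prime to `𝔤`

Topic `NumberTheory/ComplexMultiplication/EllipticUnits`; namespace
`Literature.NumberTheory.ComplexMultiplication.EllipticUnits`. Cell `bsd-print-cf2`, width seat
`bsd-line-cf2-p1-w2` g18, half (α) of the (LZ)/`hZC` split with `bsd-line-cf2-p1-w5` g10 (the converse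
"Rubin `Θ₀`-generator ↦ Kato representative" needs to move an ARBITRARY CM lattice `L` with a primitive
`𝔤`-division point `v` — the data of Rubin's `α_{τ,𝔞}(1)`, `rubinGenerators` — to Kato's lattice `ι(𝔤)`
with division point `1`). `--supports` the deciding child stmt-BirchSwinnertonDyer-24721. THEOREMS ONLY (no
`def`, no named fact, no `sorry`); nothing here is specific to `p` or to BSD.

WHAT IS PROVED (`K` imaginary quadratic, `ι : K →+* ℂ`, `Λ` the lattice of a period pair `L` with
`𝒪_K`-multiplication (`IsCMLattice ι Λ`), `𝔤 ≠ 0, 𝒪_K` an integral ideal, `v` a primitive `𝔤`-division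
point of `Λ` (`IsPrimitiveDivisionPoint`), `P` a period pair with lattice `ι(𝔤)`):
* §1 `exists_eq_apply_of_mem_lattice` — **rationality**: a period-pair lattice containing `ι(𝔤)` lies in `ι(K)` (it spans with `ι(𝔤)` the
  `2`-dimensional `ℚ`-space `ι(K)`; dimension count);
* §2 ★ **`exists_ideal_mulLeft_inv_lattice_eq_idealInvLattice`** — **normal form**: there is an integral
  ideal `𝔠 ≠ 0`, COPRIME to `𝔤`, with `v⁻¹Λ = 𝔠⁻¹ι(𝔤)` (`idealInvLattice ι 𝔠 P.lattice`); i.e. the pair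
  `(Λ, v)` is the `v`-homothetic image of de Shalit's pair `(𝔠⁻¹ι(𝔤), 1)` — the shape on which II.2.4 (ii)
  "`Θ(1; 𝔤, 𝔞)^{σ_𝔠} = Θ(1; 𝔠⁻¹ι(𝔤), 𝔞)`" speaks. (`J = ι⁻¹(v⁻¹Λ)` is a fractional ideal containing `𝔤`
  with `J ∩ 𝒪_K = 𝔤` by primitivity; `𝔠 := 𝔤J⁻¹`; Dedekind arithmetic of `FractionalIdeal (𝓞 K)⁰ K`.)
HONEST FRAMING: elementary CM-lattice bookkeeping (Silverman, *Advanced Topics* II.1.1–1.2; de Shalit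
II.1.3); unconditional. presearch: tree has the principal case (`RubinTheta.idealInvLattice_span_singleton`,
`CMLatticeHomothety` for `h = 1`) but no division-point normal form — none in corpus/galaxy by name.

## References
* [Silverman1994] J. Silverman, *Advanced Topics in the Arithmetic of Elliptic Curves*, Ch. II §1.1
  Prop. 1.1–1.2 (lattices with CM are fractional ideals up to homothety).
* [deShalit1987] E. de Shalit, *Iwasawa theory of elliptic curves with complex multiplication* (1987),
  II.1.3, II.2.4 Proposition.
-/

noncomputable section

open scoped Classical nonZeroDivisors
open Field NumberField IsDedekindDomain
open Literature.NumberTheory.EllipticCurves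

namespace Literature.NumberTheory.ComplexMultiplication.EllipticUnits

variable {K : Type} [Field K] [NumberField K]

/-! ## §1. Rationality: `v⁻¹Λ ⊆ ι(K)` -/

/-- **A full sublattice of `ι(K)`-vectors forces rationality**: if the lattice `Λ′` of a period pair
contains `ι(𝔤)` for a non-zero ideal `𝔤` of the imaginary quadratic field `K`, then `Λ′ ⊆ ι(K)` — both
`ℚΛ′` and `ι(K) = ℚ·ι(𝔤)` are `2`-dimensional over `ℚ` and `ι(K) ⊆ ℚΛ′`.
[cite: Silverman1994, Ch. II §1.1 Prop. 1.1] -/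
theorem exists_eq_apply_of_mem_lattice (hK : IsImaginaryQuadratic K) (ι : K →+* ℂ) {𝔤 : Ideal (𝓞 K)}
    (h𝔤 : 𝔤 ≠ ⊥) {M : PeriodPair} (hgM : ∀ g ∈ 𝔤, ι (g : K) ∈ M.lattice) {z : ℂ} (hz : z ∈ M.lattice) :
    ∃ y : K, ι y = z := by
  -- the `ℚ`-span `V` of `Λ′` and the `ℚ`-subspace `W = ι(K)`
  let V : Submodule ℚ ℂ := Submodule.span ℚ ((({M.ω₁, M.ω₂} : Finset ℂ) : Set ℂ))
  haveI : FiniteDimensional ℚ V := FiniteDimensional.span_of_finite ℚ (Finset.finite_toSet _)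
  have hMV : ∀ x ∈ M.lattice, x ∈ V := by
    intro x hx
    obtain ⟨m, n, rfl⟩ := PeriodPair.mem_lattice.mp hx
    have h₁ : M.ω₁ ∈ V := Submodule.subset_span (by simp)
    have h₂ : M.ω₂ ∈ V := Submodule.subset_span (by simp)
    have e₁ : (m : ℂ) * M.ω₁ = (m : ℚ) • M.ω₁ := by rw [Rat.smul_def]; push_cast; rfl
    have e₂ : (n : ℂ) * M.ω₂ = (n : ℚ) • M.ω₂ := by rw [Rat.smul_def]; push_cast; rfl
    rw [e₁, e₂]
    exact V.add_mem (V.smul_mem _ h₁) (V.smul_mem _ h₂)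
  have hVfin : Module.finrank ℚ V ≤ 2 :=
    (finrank_span_finset_le_card (R := ℚ) ({M.ω₁, M.ω₂} : Finset ℂ)).trans Finset.card_le_two
  let ιℚ : K →ₗ[ℚ] ℂ := ι.toRatAlgHom.toLinearMap
  let W : Submodule ℚ ℂ := LinearMap.range ιℚ
  have hιℚ : ∀ y : K, ιℚ y = ι y := fun _ ↦ rfl
  have hWfin : Module.finrank ℚ W = 2 := by
    rw [LinearMap.finrank_range_of_inj (by intro a b h; exact ι.injective (by simpa [hιℚ] using h)), hK.1]
  -- `W ≤ V`: every `ι(y)` is a rational multiple of an element of `ι(𝔤)`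
  have hWV : W ≤ V := by
    rintro _ ⟨y, rfl⟩
    rw [hιℚ]
    -- `n₀ = N𝔤 ∈ 𝔤`; `b • y = a ∈ 𝒪_K` with `b ∈ 𝒪_K ∖ 0`, `n_b = N(b) = b′b ∈ ℕ ∖ 0`
    have hn₀ : ((Ideal.absNorm 𝔤 : ℕ) : 𝓞 K) ∈ 𝔤 := Ideal.absNorm_mem 𝔤
    have hn₀0 : (Ideal.absNorm 𝔤 : ℕ) ≠ 0 := Ideal.absNorm_eq_zero_iff.not.mpr h𝔤
    obtain ⟨⟨b, hb⟩, a, ha⟩ := IsLocalization.exists_integer_multiple (nonZeroDivisors (𝓞 K)) y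
    have hb0 : b ≠ 0 := nonZeroDivisors.ne_zero hb
    have hnb : ((Ideal.absNorm (Ideal.span {b}) : ℕ) : 𝓞 K) ∈ Ideal.span {b} := Ideal.absNorm_mem _
    have hnb0 : (Ideal.absNorm (Ideal.span {b}) : ℕ) ≠ 0 :=
      Ideal.absNorm_eq_zero_iff.not.mpr (mt Ideal.span_singleton_eq_bot.mp hb0)
    obtain ⟨b', hb'⟩ := Ideal.mem_span_singleton'.mp hnb
    -- the element `n₀ b′ a ∈ 𝔤` and the rational `q = n₀ n_b`
    have hmem : ((Ideal.absNorm 𝔤 : ℕ) : 𝓞 K) * (b' * a) ∈ 𝔤 := 𝔤.mul_mem_right _ hn₀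
    have ha' : algebraMap (𝓞 K) K a = algebraMap (𝓞 K) K b * y := by
      rw [ha]
      change (b : 𝓞 K) • y = _
      rw [Algebra.smul_def]
    have hq : ((Ideal.absNorm 𝔤 : ℕ) * (Ideal.absNorm (Ideal.span {b}) : ℕ) : ℚ) ≠ 0 :=
      mul_ne_zero (by exact_mod_cast hn₀0) (by exact_mod_cast hnb0)
    have hcast : ((((Ideal.absNorm 𝔤 : ℕ) : 𝓞 K) * (b' * a) : 𝓞 K) : K) =
        (((Ideal.absNorm 𝔤 : ℕ) * (Ideal.absNorm (Ideal.span {b}) : ℕ) : ℚ)) • y := by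
      have hb'' : algebraMap (𝓞 K) K b' * algebraMap (𝓞 K) K b = ((Ideal.absNorm (Ideal.span {b}) : ℕ) : K) := by
        rw [← map_mul, hb', map_natCast]
      rw [RingOfIntegers.coe_eq_algebraMap, map_mul, map_mul, map_natCast, ha', ← mul_assoc (algebraMap (𝓞 K) K b'),
        hb'', Rat.smul_def]
      push_cast
      ring
    have key : ι y = (((Ideal.absNorm 𝔤 : ℕ) * (Ideal.absNorm (Ideal.span {b}) : ℕ) : ℚ))⁻¹ •
        ι ((((Ideal.absNorm 𝔤 : ℕ) : 𝓞 K) * (b' * a) : 𝓞 K) : K) := by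
      rw [hcast, map_rat_smul ι, smul_smul, inv_mul_cancel₀ hq, one_smul]
    rw [key]
    exact V.smul_mem _ (hMV _ (hgM _ hmem))
  -- dimension count: `V = W`
  have hVW : W = V := Submodule.eq_of_le_of_finrank_le hWV (by rw [hWfin]; exact hVfin)
  have hzW : z ∈ W := by rw [hVW]; exact hMV z hz
  obtain ⟨y, hy⟩ := hzW
  exact ⟨y, hy⟩

/-! ## §2. The normal form `v⁻¹Λ = 𝔠⁻¹ι(𝔤)` -/

/-- **NORMAL FORM OF A CM LATTICE RELATIVE TO A PRIMITIVE DIVISION POINT.** `K` imaginary quadratic,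
`ι : K → ℂ`; `Λ` the lattice of a period pair `L` with `𝒪_K`-multiplication; `𝔤 ≠ 0, 𝒪_K`; `v ≠ 0` a
primitive `𝔤`-division point of `Λ` (annihilator of `v mod Λ` exactly `𝔤`); `P` a period pair with lattice
`ι(𝔤)`. Then there is an integral ideal `𝔠 ≠ 0`, COPRIME to `𝔤`, with **`v⁻¹Λ = 𝔠⁻¹ι(𝔤)`**
(`idealInvLattice ι 𝔠 P.lattice`): the pair `(Λ, v)` is `v · (𝔠⁻¹ι(𝔤), 1)`. Proof: `J = ι⁻¹(v⁻¹Λ)` is a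
fractional ideal (§1) with `𝔤 ≤ J` and `J ∩ 𝒪_K = 𝔤` (primitivity); `𝔠 := 𝔤J⁻¹` is integral, `𝔠J = 𝔤`;
if `𝔡 = 𝔠 + 𝔤` then `𝔤𝔡⁻¹ ≤ 𝔤𝔠⁻¹ ∩ 𝒪_K = J ∩ 𝒪_K = 𝔤`, so `𝔡⁻¹ ≤ 1`, `𝔡 = 𝒪_K`; and
`z ∈ 𝔠⁻¹ι(𝔤) ⟺ ι⁻¹(z)·𝔠 ≤ 𝔤 ⟺ ι⁻¹(z) ∈ 𝔤𝔠⁻¹ = J`.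
[cite: Silverman1994, Ch. II §1.1 Prop. 1.1–1.2] [cite: deShalit1987, II.1.3 and II.2.4 Proposition] -/
theorem exists_ideal_mulLeft_inv_lattice_eq_idealInvLattice (hK : IsImaginaryQuadratic K) (ι : K →+* ℂ)
    {L P : PeriodPair} (hL : IsCMLattice ι L.lattice) {𝔤 : Ideal (𝓞 K)} (h𝔤 : 𝔤 ≠ ⊥)
    {v : ℂ} (hv : IsPrimitiveDivisionPoint ι 𝔤 L.lattice v) (hv0 : v ≠ 0)
    (hP : ∀ z : ℂ, z ∈ P.lattice ↔ ∃ g ∈ 𝔤, z = ι (g : K)) :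
    ∃ 𝔠 : Ideal (𝓞 K), 𝔠 ≠ ⊥ ∧ IsCoprime 𝔠 𝔤 ∧
      (L.mulLeft v⁻¹ (inv_ne_zero hv0)).lattice = idealInvLattice ι 𝔠 P.lattice := by
  -- the lattice `M = v⁻¹Λ ⊇ ι(𝔤)`, with `𝒪_K`-multiplication
  have hmemM : ∀ z : ℂ, z ∈ (L.mulLeft v⁻¹ (inv_ne_zero hv0)).lattice ↔ v * z ∈ L.lattice := fun z ↦ by
    rw [PeriodPair.mem_mulLeft_lattice, inv_inv]
  have hgM : ∀ g ∈ 𝔤, ι (g : K) ∈ (L.mulLeft v⁻¹ (inv_ne_zero hv0)).lattice := fun g hg ↦ by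
    rw [hmemM, mul_comm]; exact (hv g).mpr hg
  have hMcm : IsCMLattice ι (L.mulLeft v⁻¹ (inv_ne_zero hv0)).lattice := isCMLattice_mulLeft hL _ _
  have hint : ∀ a : 𝓞 K, ι (a : K) ∈ (L.mulLeft v⁻¹ (inv_ne_zero hv0)).lattice → a ∈ 𝔤 := fun a ha ↦ by
    rw [hmemM, mul_comm] at ha; exact (hv a).mp ha
  -- rationality: generators `y₁, y₂ ∈ K` of `M`
  obtain ⟨y₁, hy₁⟩ := exists_eq_apply_of_mem_lattice hK ι h𝔤 hgM (L.mulLeft v⁻¹ (inv_ne_zero hv0)).ω₁_mem_lattice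
  obtain ⟨y₂, hy₂⟩ := exists_eq_apply_of_mem_lattice hK ι h𝔤 hgM (L.mulLeft v⁻¹ (inv_ne_zero hv0)).ω₂_mem_lattice
  -- the fractional ideal `J = 𝒪_K y₁ + 𝒪_K y₂ = ι⁻¹(M)`
  let J : Submodule (𝓞 K) K := Submodule.span (𝓞 K) {y₁, y₂}
  have hJM : ∀ y : K, y ∈ J ↔ ι y ∈ (L.mulLeft v⁻¹ (inv_ne_zero hv0)).lattice := by
    intro y
    constructor
    · intro hy
      induction hy using Submodule.span_induction with
      | mem x hx =>
        simp only [Set.mem_insert_iff, Set.mem_singleton_iff] at hx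
        rcases hx with rfl | rfl
        · rw [hy₁]; exact PeriodPair.ω₁_mem_lattice _
        · rw [hy₂]; exact PeriodPair.ω₂_mem_lattice _
      | zero => rw [map_zero]; exact Submodule.zero_mem _
      | add x y _ _ hx hy => rw [map_add]; exact Submodule.add_mem _ hx hy
      | smul a x _ hx => rw [Algebra.smul_def, map_mul]; exact hMcm a _ hx
    · intro hy
      obtain ⟨m, n, hmn⟩ := PeriodPair.mem_lattice.mp hy
      have hy' : y = (m : 𝓞 K) • y₁ + (n : 𝓞 K) • y₂ := by
        apply ι.injective
        rw [← hmn, map_add, Algebra.smul_def, Algebra.smul_def, map_mul, map_mul, hy₁, hy₂]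
        simp
      rw [hy']
      exact J.add_mem (J.smul_mem _ (Submodule.subset_span (by simp))) (J.smul_mem _ (Submodule.subset_span (by simp)))
  let Jf : FractionalIdeal (𝓞 K)⁰ K :=
    ⟨J, FractionalIdeal.isFractional_of_fg (Submodule.fg_span (Set.toFinite _))⟩
  have hJf : ∀ y : K, y ∈ Jf ↔ ι y ∈ (L.mulLeft v⁻¹ (inv_ne_zero hv0)).lattice := fun y ↦ hJM y
  -- `𝔤 ≤ J`, `J ≠ 0`, integral elements of `J` lie in `𝔤`
  have h𝔤J : (𝔤 : FractionalIdeal (𝓞 K)⁰ K) ≤ Jf := by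
    intro x hx
    obtain ⟨g, hg, rfl⟩ := (FractionalIdeal.mem_coeIdeal _).mp hx
    exact (hJf _).mpr (hgM g hg)
  obtain ⟨g₀, hg₀, hg₀0⟩ := Submodule.exists_mem_ne_zero_of_ne_bot h𝔤
  have hJ0 : Jf ≠ 0 := by
    intro h0
    have h1 : algebraMap (𝓞 K) K g₀ ∈ Jf := h𝔤J (FractionalIdeal.mem_coeIdeal_of_mem _ hg₀)
    rw [h0, FractionalIdeal.mem_zero_iff] at h1
    exact hg₀0 (IsFractionRing.to_map_eq_zero_iff.mp h1)
  have hintJ : ∀ a : 𝓞 K, algebraMap (𝓞 K) K a ∈ Jf → a ∈ 𝔤 := fun a ha ↦ hint a ((hJf _).mp ha)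
  -- `𝔠 := 𝔤 J⁻¹` is integral, `𝔠 J = 𝔤`
  have hCle : (𝔤 : FractionalIdeal (𝓞 K)⁰ K) * Jf⁻¹ ≤ 1 := by
    calc (𝔤 : FractionalIdeal (𝓞 K)⁰ K) * Jf⁻¹ ≤ Jf * Jf⁻¹ := mul_le_mul_left h𝔤J _
      _ = 1 := mul_inv_cancel₀ hJ0
  obtain ⟨𝔠, h𝔠⟩ := FractionalIdeal.le_one_iff_exists_coeIdeal.mp hCle
  have h𝔠J : (𝔠 : FractionalIdeal (𝓞 K)⁰ K) * Jf = 𝔤 := by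
    rw [h𝔠, mul_assoc, inv_mul_cancel₀ hJ0, mul_one]
  have h𝔤0 : (𝔤 : FractionalIdeal (𝓞 K)⁰ K) ≠ 0 := FractionalIdeal.coeIdeal_ne_zero.mpr h𝔤
  have h𝔠0 : (𝔠 : FractionalIdeal (𝓞 K)⁰ K) ≠ 0 := by
    intro h0; rw [h0, zero_mul] at h𝔠J; exact h𝔤0 h𝔠J.symm
  have h𝔠ne : 𝔠 ≠ ⊥ := FractionalIdeal.coeIdeal_ne_zero.mp h𝔠0
  have hJeq : Jf = (𝔤 : FractionalIdeal (𝓞 K)⁰ K) * (𝔠 : FractionalIdeal (𝓞 K)⁰ K)⁻¹ := by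
    rw [← h𝔠J, mul_comm ((𝔠 : FractionalIdeal (𝓞 K)⁰ K)) Jf, mul_assoc, mul_inv_cancel₀ h𝔠0, mul_one]
  refine ⟨𝔠, h𝔠ne, ?_, ?_⟩
  · -- coprimality: `𝔡 = 𝔠 + 𝔤` has `𝔡⁻¹ ≤ 1`
    rw [Ideal.isCoprime_iff_sup_eq]
    set 𝔡 : Ideal (𝓞 K) := 𝔠 ⊔ 𝔤 with h𝔡
    have h𝔡0 : (𝔡 : FractionalIdeal (𝓞 K)⁰ K) ≠ 0 :=
      FractionalIdeal.coeIdeal_ne_zero.mpr fun h ↦ h𝔠ne (le_bot_iff.mp (h ▸ le_sup_left))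
    have h𝔠𝔡 : (𝔠 : FractionalIdeal (𝓞 K)⁰ K) ≤ 𝔡 := (FractionalIdeal.coeIdeal_le_coeIdeal K).mpr le_sup_left
    have h𝔤𝔡 : (𝔤 : FractionalIdeal (𝓞 K)⁰ K) ≤ 𝔡 := (FractionalIdeal.coeIdeal_le_coeIdeal K).mpr le_sup_right
    -- `𝔤 𝔡⁻¹ ≤ J` and `𝔤 𝔡⁻¹ ≤ 1`, hence `𝔤 𝔡⁻¹ ≤ 𝔤`
    have h1 : (𝔤 : FractionalIdeal (𝓞 K)⁰ K) * (𝔡 : FractionalIdeal (𝓞 K)⁰ K)⁻¹ ≤ Jf := by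
      rw [hJeq]
      exact mul_le_mul_right (FractionalIdeal.inv_anti_mono h𝔠0 h𝔡0 h𝔠𝔡) _
    have h2 : (𝔤 : FractionalIdeal (𝓞 K)⁰ K) * (𝔡 : FractionalIdeal (𝓞 K)⁰ K)⁻¹ ≤ 1 := by
      calc (𝔤 : FractionalIdeal (𝓞 K)⁰ K) * (𝔡 : FractionalIdeal (𝓞 K)⁰ K)⁻¹
          ≤ (𝔡 : FractionalIdeal (𝓞 K)⁰ K) * (𝔡 : FractionalIdeal (𝓞 K)⁰ K)⁻¹ := mul_le_mul_left h𝔤𝔡 _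
        _ = 1 := mul_inv_cancel₀ h𝔡0
    have h3 : (𝔤 : FractionalIdeal (𝓞 K)⁰ K) * (𝔡 : FractionalIdeal (𝓞 K)⁰ K)⁻¹ ≤ 𝔤 := by
      obtain ⟨I, hI⟩ := FractionalIdeal.le_one_iff_exists_coeIdeal.mp h2
      intro x hx
      have hxI : x ∈ (I : FractionalIdeal (𝓞 K)⁰ K) := by rw [hI]; exact hx
      obtain ⟨a, -, rfl⟩ := (FractionalIdeal.mem_coeIdeal _).mp hxI
      exact FractionalIdeal.mem_coeIdeal_of_mem _ (hintJ a (h1 hx))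
    -- so `𝔡⁻¹ ≤ 1` and `𝔡 = 1`
    have h4 : (𝔡 : FractionalIdeal (𝓞 K)⁰ K)⁻¹ ≤ 1 := by
      have := mul_le_mul_right h3 (𝔤 : FractionalIdeal (𝓞 K)⁰ K)⁻¹
      rwa [← mul_assoc, inv_mul_cancel₀ h𝔤0, one_mul] at this
    have h5 : (1 : FractionalIdeal (𝓞 K)⁰ K) ≤ 𝔡 := by
      have := mul_le_mul_right h4 (𝔡 : FractionalIdeal (𝓞 K)⁰ K)
      rwa [mul_inv_cancel₀ h𝔡0, mul_one] at this
    have h6 : (𝔡 : FractionalIdeal (𝓞 K)⁰ K) = 1 := le_antisymm FractionalIdeal.coeIdeal_le_one h5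
    rw [FractionalIdeal.coeIdeal_eq_one] at h6
    rw [h6, Ideal.one_eq_top]
  · -- the lattice identity `M = 𝔠⁻¹ι(𝔤)`
    ext z
    rw [mem_idealInvLattice_iff]
    constructor
    · intro hz c hc
      obtain ⟨y, rfl⟩ := exists_eq_apply_of_mem_lattice hK ι h𝔤 hgM hz
      have hcy : algebraMap (𝓞 K) K c * y ∈ (𝔤 : FractionalIdeal (𝓞 K)⁰ K) := by
        rw [← h𝔠J]
        exact FractionalIdeal.mul_mem_mul (FractionalIdeal.mem_coeIdeal_of_mem _ hc) ((hJf y).mpr hz)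
      obtain ⟨g, hg, hgy⟩ := (FractionalIdeal.mem_coeIdeal _).mp hcy
      rw [hP]
      refine ⟨g, hg, ?_⟩
      rw [RingOfIntegers.coe_eq_algebraMap g, hgy, map_mul, RingOfIntegers.coe_eq_algebraMap c]
    · intro hz
      obtain ⟨c₀, hc₀, hc₀0⟩ := Submodule.exists_mem_ne_zero_of_ne_bot h𝔠ne
      obtain ⟨g₀', hg₀', hz₀⟩ := (hP _).mp (hz c₀ hc₀)
      have hc₀K : ι (c₀ : K) ≠ 0 := (map_ne_zero ι).mpr (RingOfIntegers.coe_ne_zero_iff.mpr hc₀0)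
      -- `z = ι(y)` with `y = g₀′/c₀`
      set y : K := (g₀' : K) / (c₀ : K) with hy
      have hzy : z = ι y := by
        rw [hy, map_div₀, eq_div_iff hc₀K, mul_comm]
        exact hz₀
      -- `y 𝔠 ≤ 𝔤`
      have hyc : FractionalIdeal.spanSingleton (𝓞 K)⁰ y * (𝔠 : FractionalIdeal (𝓞 K)⁰ K) ≤ 𝔤 := by
        rw [FractionalIdeal.mul_le]
        intro i hi j hj
        obtain ⟨r, rfl⟩ := (FractionalIdeal.mem_spanSingleton (S := (𝓞 K)⁰)).mp hi
        obtain ⟨c, hc, rfl⟩ := (FractionalIdeal.mem_coeIdeal _).mp hj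
        obtain ⟨g, hg, hgz⟩ := (hP _).mp (hz c hc)
        rw [hzy, ← map_mul] at hgz
        have hcy : algebraMap (𝓞 K) K c * y = (g : K) := ι.injective hgz
        rw [smul_mul_assoc, mul_comm y, hcy, Algebra.smul_def, ← map_mul]
        exact FractionalIdeal.mem_coeIdeal_of_mem _ (𝔤.mul_mem_left r hg)
      have hyJ : y ∈ Jf := by
        rw [← FractionalIdeal.spanSingleton_le_iff_mem, hJeq]
        calc FractionalIdeal.spanSingleton (𝓞 K)⁰ y
            = FractionalIdeal.spanSingleton (𝓞 K)⁰ y * (𝔠 : FractionalIdeal (𝓞 K)⁰ K) *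
                (𝔠 : FractionalIdeal (𝓞 K)⁰ K)⁻¹ := by rw [mul_assoc, mul_inv_cancel₀ h𝔠0, mul_one]
          _ ≤ (𝔤 : FractionalIdeal (𝓞 K)⁰ K) * (𝔠 : FractionalIdeal (𝓞 K)⁰ K)⁻¹ :=
                mul_le_mul_left hyc _
      rw [hzy]
      exact (hJf y).mp hyJ

end Literature.NumberTheory.ComplexMultiplication.EllipticUnits

end
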